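import Summits.BirchSwinnertonDyer.BirchSwinnertonDyer.Theorems.ByReductionTypeAtTwoAnalyticMuFlat
import HarnessLib

/-!
# Route `ByReductionTypeAtTwo` (K4), crux `OrdMissingLowerBoundAtTwo` (stmt-BirchSwinnertonDyer-19577), line
# `kato-free-lower-sandwich-two` — S2 complete at the optimal curve: measure depth / `¬ AnalyticMuLE` ⟹ a `2^{s+1}`-FLAT
# winding profile with slope of order dividing `4` (`--supports`, helper; packaging of `…AnalyticMuFlat`)

Cell `bsd-2adic`, lead `cruxlead-stmt-BirchSwinnertonDyer-19577` (g0).  THEOREMS ONLY — no definition, no named fact, no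
`sorry`; closes nothing; BSD is not proved by any of this.

* `forall_norm_two_mul_msdMeasure_intCast_le_of_levels_two` — from the doubled values at levels `≥ 2` / odd classes (the
  shape produced by `…AnalyticMuDepth` and consumed by the research stub of skeleton v6) to all levels `≥ 1` / odd integers
  (distribution relation for level `1`).
* `exists_slope_winding_flat_of_measure_depth` — S2 (both halves) mod `2^{s+1}`: a slope `sl ∈ ℤ/2^{s+1}`, `4·sl = 0`, with
  `2([b/2ᵏ]⁺ − [0]⁺) ≡ k·sl` for all `k ≥ 0`, `b` odd (the input shape `MultiFlatWith · (2^{s+1}) sl ∧ addOrderOf sl ∣ 4` of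
  the crux-dir sketch's S3 `eisenstein_of_multiFlat`, read on the 2-power cusps).
* `exists_slope_winding_flat_of_not_analyticMuLE_of_optimal` — the same at a globally minimal good-ordinary `W` with a
  lattice-optimal parametrisation datum at level `N_W`, from `¬ AnalyticMuLE W 2 s`, modulo Abbes–Ullmo (`a₂ = ±1` by Hasse).

References: B. Mazur, J. Tate, J. Teitelbaum, Invent. Math. 84 (1986), §I.4, §I.10; A. Abbes, E. Ullmo, Compositio 103 (1996).
-/

-- the summit namespace repeats `BirchSwinnertonDyer` by design (summit = problem); linter moot
set_option linter.dupNamespace false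
set_option autoImplicit false

noncomputable section

namespace Summit.BirchSwinnertonDyer.BirchSwinnertonDyer.Theorems.AnalyticMuTwo

open Filter Topology Finset
open scoped MatrixGroups ModularForm
open CongruenceSubgroup WeierstrassCurve Literature.NumberTheory.EllipticCurves
  Literature.NumberTheory.EllipticCurves.ModularForms Literature.NumberTheory.EllipticCurves.Rank1Residual

/-! ## Packaging: levels, `ZMod (2^{s+1})`, and the curve -/

section Package

variable {N : ℕ} [NeZero N] (f : CuspForm (Gamma0 N) 2) (α : ℚ_[2])

omit [NeZero N] in
/-- From the doubled values at levels `≥ 2` and odd classes (the shape of the research stub of skeleton v6) to the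
doubled values at all levels `≥ 1` and odd integers, by the distribution relation for level `1`. [folklore] -/
theorem forall_norm_two_mul_msdMeasure_intCast_le_of_levels_two
    (hdist : ∀ (n : ℕ) (a : ZMod (2 ^ n)),
      ∑ b ∈ Finset.univ.filter (fun b : ZMod (2 ^ (n + 1)) ↦
        ZMod.castHom (pow_dvd_pow 2 n.le_succ) (ZMod (2 ^ n)) b = a), msdMeasure f α (n + 1) b =
        msdMeasure f α n a)
    {B : ℝ} (hB : 0 ≤ B)
    (hν : ∀ (n : ℕ) (b : ZMod (2 ^ (n + 2))), ¬ 2 ∣ b.val → ‖2 * msdMeasure f α (n + 2) b‖ ≤ B)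
    (m : ℕ) (b : ℤ) (hb : Odd b) : ‖2 * msdMeasure f α (m + 1) (b : ZMod (2 ^ (m + 1)))‖ ≤ B := by
  haveI : ∀ k, NeZero (2 ^ k) := fun k => ⟨pow_ne_zero _ two_ne_zero⟩
  have hodd : ∀ k : ℕ, 1 ≤ k → ¬ 2 ∣ ((b : ZMod (2 ^ k))).val := by
    intro k hk h2
    have hval : (((b : ZMod (2 ^ k)).val : ℕ) : ℤ) = b % (2 ^ k : ℕ) := ZMod.val_intCast b
    have h2' : (2 : ℤ) ∣ b % (2 ^ k : ℕ) := by rw [← hval]; exact_mod_cast h2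
    obtain ⟨k', rfl⟩ : ∃ k', k = k' + 1 := ⟨k - 1, by omega⟩
    have hpk : (2 : ℤ) ∣ ((2 ^ (k' + 1) : ℕ) : ℤ) := by push_cast; exact dvd_pow_self 2 (Nat.succ_ne_zero k')
    have hb2 : (2 : ℤ) ∣ b := by
      have e := Int.emod_add_mul_ediv b (2 ^ (k' + 1) : ℕ)
      rw [← e]
      exact dvd_add h2' (hpk.mul_right _)
    obtain ⟨t, ht⟩ := hb
    obtain ⟨u, hu⟩ := hb2
    omega
  cases m with
  | zero =>
    -- level 1: the sum of the two level-2 values above it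
    show ‖2 * msdMeasure f α 1 (b : ZMod (2 ^ 1))‖ ≤ B
    have h := hdist 1 (b : ZMod (2 ^ 1))
    rw [← h, Finset.mul_sum]
    refine IsUltrametricDist.norm_sum_le_of_forall_le_of_nonneg hB fun b' hb' => ?_
    rw [Finset.mem_filter] at hb'
    refine hν 0 b' ?_
    intro h2
    apply hodd 1 le_rfl
    have hc : ZMod.castHom (pow_dvd_pow 2 (Nat.le_succ 1)) (ZMod (2 ^ 1)) b' = (b : ZMod (2 ^ 1)) := hb'.2
    have hv : ((b : ZMod (2 ^ 1))).val = b'.val % 2 ^ 1 := by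
      rw [← hc, ZMod.castHom_apply, ZMod.cast_eq_val, ZMod.val_natCast]
    rw [hv]
    exact (Nat.dvd_mod_iff (by norm_num : 2 ∣ 2 ^ 1)).mpr h2
  | succ m =>
    exact hν m _ (hodd (m + 2) (by omega))

end Package

/-! ## `ZMod (2^{s+1})` packaging and the optimal curve -/

section ZModPackage

variable {N : ℕ} [NeZero N] {f : CuspForm (Gamma0 N) 2}

/-- **S2 (recursion half), packaged mod `2^{s+1}`**: under measure depth `s+1` there is a slope `sl ∈ ℤ/2^{s+1}` with
`4·sl = 0` such that every winding class `w_k(b) = 2([b/2ᵏ]⁺ − [0]⁺)` (`b` odd) is `≡ k·sl`.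
[cite: MazurTateTeitelbaum1986Invent, §I.10 (10.1) and §I.4 (4.2)] -/
theorem exists_slope_winding_flat_of_measure_depth (hf : IsNewform0 f) (hQ : coeffField f = ⊥) (h2N : ¬ 2 ∣ N)
    {a₂ : ℤ} (ha₂ : cuspCoeff f 2 = a₂) (ha₂' : a₂ = 1 ∨ a₂ = -1) {α : ℚ_[2]} (hαu : ‖α‖ = 1)
    (hroot : α ^ 2 - a₂ * α + 2 = 0) {s : ℕ}
    (hν : ∀ (m : ℕ) (b : ℤ), Odd b →
      ‖2 * msdMeasure f α (m + 1) (b : ZMod (2 ^ (m + 1)))‖ ≤ (2 : ℝ) ^ (-((s : ℤ) + 1))) :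
    ∃ sl : ZMod (2 ^ (s + 1)), 4 • sl = 0 ∧
      ∀ (k : ℕ) (b : ℤ), Odd b → ∀ z : ℤ,
        2 * (ratPlusSymbol f ((b : ℚ) / (2 : ℚ) ^ k) - ratPlusSymbol f 0) = z → ((z : ℤ) : ZMod (2 ^ (s + 1))) = k • sl := by
  haveI : Fact (Nat.Prime 2) := ⟨Nat.prime_two⟩
  have hreal : ∀ n, (cuspCoeff f n).im = 0 := cuspCoeff_im_eq_zero_of_coeffField_eq_bot hQ
  have hB : (0 : ℝ) ≤ (2 : ℝ) ^ (-((s : ℤ) + 1)) := zpow_nonneg (by norm_num) _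
  -- the slope `w₁ = 2([1/2]⁺ − [0]⁺) ∈ ℤ`
  obtain ⟨z₁, hz₁⟩ := exists_two_mul_ratPlusSymbol_sub_eq_intCast hreal h2N 1 1
  have hz₁' : 2 * (ratPlusSymbol f (1 / 2) - ratPlusSymbol f 0) = z₁ := by
    rw [← hz₁]; norm_num
  refine ⟨(z₁ : ZMod (2 ^ (s + 1))), ?_, ?_⟩
  · -- `4 sl = 0`
    have h4 := norm_four_mul_winding_one_le_of_measure_depth hf hQ h2N ha₂ ha₂' hαu hroot hB hν
    rw [hz₁', show (((4 : ℚ) * (z₁ : ℚ) : ℚ) : ℚ_[2]) = (((4 * z₁ : ℤ)) : ℚ_[2]) by push_cast; ring] at h4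
    have hdvd : ((2 : ℤ) ^ (s + 1)) ∣ 4 * z₁ := (Padic.norm_int_le_pow_iff_dvd _ _).mp (by exact_mod_cast h4)
    have : ((4 * z₁ : ℤ) : ZMod (2 ^ (s + 1))) = 0 :=
      (ZMod.intCast_zmod_eq_zero_iff_dvd _ _).mpr (by exact_mod_cast hdvd)
    rw [nsmul_eq_mul]
    exact_mod_cast this
  · intro k b hb z hz
    have h := norm_winding_sub_mul_le_of_measure_depth hf hQ h2N ha₂ hαu hroot hB hν k hb
    rw [hz, hz₁', show (((z : ℚ) - (k : ℚ) * (z₁ : ℚ) : ℚ) : ℚ_[2]) = (((z - k * z₁ : ℤ)) : ℚ_[2]) by push_cast; ring] at h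
    have hdvd : ((2 : ℤ) ^ (s + 1)) ∣ z - k * z₁ := (Padic.norm_int_le_pow_iff_dvd _ _).mp (by exact_mod_cast h)
    have h0 : ((z - k * z₁ : ℤ) : ZMod (2 ^ (s + 1))) = 0 :=
      (ZMod.intCast_zmod_eq_zero_iff_dvd _ _).mpr (by exact_mod_cast hdvd)
    rw [nsmul_eq_mul]
    have : ((z : ℤ) : ZMod (2 ^ (s + 1))) - (k : ZMod (2 ^ (s + 1))) * (z₁ : ZMod (2 ^ (s + 1))) = 0 := by
      exact_mod_cast h0
    exact sub_eq_zero.mp this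

end ZModPackage

section Curve

variable (W : WeierstrassCurve ℚ) [W.IsElliptic] [W.IsGloballyMinimal]

/-- **S2 in full at the `X₀(N)`-optimal curve (mod Abbes–Ullmo): `¬ AnalyticMuLE W 2 s` ⟹ the winding classes of the
newform's plus symbol at the 2-power cusps are `2^{s+1}`-flat of a slope of order dividing `4`.**  `W` globally minimal,
good ordinary at `2`, `D` a lattice-optimal parametrisation datum at level `N_W`; combines `…AnalyticMuDepth`
(`norm_two_mul_msdMeasure_le_of_not_analyticMuLE_of_optimal`), the level bridge and the recursion half; `a₂ = ±1` by Hasse.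
[cite: AbbesUllmo1996, Thm. A] [cite: MazurTateTeitelbaum1986Invent, §I.10 (10.1)] -/
theorem exists_slope_winding_flat_of_not_analyticMuLE_of_optimal
    (hAU : abbesUllmo_not_dvd_maninConstant_of_not_dvd_level) (hord : IsOrdinaryAt W 2)
    [NeZero (W.conductorNorm ℤ)] (D : ModularParametrizationData W (W.conductorNorm ℤ))
    (hopt : ∀ z ∈ D.L.lattice, ∃ w ∈ periodLattice D.f, z = D.c * w) {s : ℕ}
    (hnot : ¬ Summit.BirchSwinnertonDyer.Rank1Residual.X1.MuPart.AnalyticMuLE W 2 s) :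
    ∃ sl : ZMod (2 ^ (s + 1)), 4 • sl = 0 ∧
      ∀ (k : ℕ) (b : ℤ), Odd b → ∀ z : ℤ,
        2 * (ratPlusSymbol D.f ((b : ℚ) / (2 : ℚ) ^ k) - ratPlusSymbol D.f 0) = z →
          ((z : ℤ) : ZMod (2 ^ (s + 1))) = k • sl := by
  haveI : Fact (Nat.Prime 2) := ⟨Nat.prime_two⟩
  obtain ⟨hαeq, hαu, hα0⟩ := unitRoot_coe_spec (W := W) hord
  have hf := D.isNewformOf
  have hQ : coeffField D.f = ⊥ := hf.coeffField_eq_bot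
  have h2N : ¬ 2 ∣ W.conductorNorm ℤ := not_dvd_level_of_isNewformOf hf hord.1
  have ha₂ : cuspCoeff D.f 2 = ((W.frobeniusTrace 2 : ℤ) : ℂ) := cuspCoeff_eq_frobeniusTrace_of_isNewformOf_holds hf hord.1
  -- `a₂ = ±1`: odd (ordinary) and `a₂² ≤ 8` (Hasse)
  have ha₂' : W.frobeniusTrace 2 = 1 ∨ W.frobeniusTrace 2 = -1 := by
    have hH : W.frobeniusTrace 2 ^ 2 ≤ 8 := by
      have h := W.frobeniusTrace_sq_le_four_mul 2 hord.1
      push_cast at h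
      linarith
    have hodd : ¬ (2 : ℤ) ∣ W.frobeniusTrace 2 := by exact_mod_cast hord.2
    have hb : -2 ≤ W.frobeniusTrace 2 ∧ W.frobeniusTrace 2 ≤ 2 := by
      constructor <;> nlinarith [hH, sq_nonneg (W.frobeniusTrace 2 + 3), sq_nonneg (W.frobeniusTrace 2 - 3)]
    omega
  have hroot : (unitRoot W 2 : ℚ_[2]) ^ 2 - (W.frobeniusTrace 2 : ℤ) * (unitRoot W 2 : ℚ_[2]) + 2 = 0 := by
    have := hαeq; push_cast at this ⊢; exact this
  have hdepth := norm_two_mul_msdMeasure_le_of_not_analyticMuLE_of_optimal W hAU hord D hopt hnot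
  have hB : (0 : ℝ) ≤ (2 : ℝ) ^ (-((s : ℤ) + 1)) := zpow_nonneg (by norm_num) _
  have hν := forall_norm_two_mul_msdMeasure_intCast_le_of_levels_two D.f (unitRoot W 2 : ℚ_[2])
    (msdMeasure_distribution_of_isNewformOf hord hf) hB (fun n b hb => hdepth n hb)
  exact exists_slope_winding_flat_of_measure_depth hf.1 hQ h2N ha₂ ha₂' hαu hroot hν

end Curve

end Summit.BirchSwinnertonDyer.BirchSwinnertonDyer.Theorems.AnalyticMuTwo

end
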